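import Mathlib
import HarnessLib
import HarnessLib.Audit
import Summits.Parity.Statement
import Literature.NumberTheory.LFunctions.NoRealZeroPrimeSumCriterion
import Literature.NumberTheory.LFunctions.RealCharacterLadderLeaves
import Literature.NumberTheory.LFunctions.NoRealZeroCertificateHeavyList15
import Literature.NumberTheory.LFunctions.NoRealZeroCertificateReplaySplit
import Literature.NumberTheory.LFunctions.NoRealZeroCertificateReplayRange001
import Literature.NumberTheory.LFunctions.NoRealZeroCertificateReplayUpTo
import HarnessLib.Audit.Status.Attr

/-!
Route: LZZCertificateReplay

CLOSED (proved) 2026-08-26T18:39:25Z by planner-parity-realchar-theory-g7-0 — reason: proved:Summit.Parity.GeneralizedHardyLittlewood.Theorems.noExceptionalZeroUpTo_4e5_fifth — note: PROVED close (theory g7, tenure planner): the route's alt-closer leaf F-P2n NoExceptionalZeroUpTo_4e5_fifth is an UNCONDITIONAL kernel theorem — Theorems.noExceptionalZeroUpTo_4e5_fifth (p459511, prover g5; axioms propext/Classical.choice/Quot.sound; chain p455858 partner-zero global Hadamard inequa. The file is kept as the record of this route; refuted decls are indexed as negative knowledge (`ledger negatives`).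

X = "for every modulus 3 ≤ q ≤ 4·10⁵, every primitive quadratic χ mod q and every σ ∈ (0,1] with σ ≥
1 − 1/(5 log q), L(σ,χ) ≠ 0" = the rung leaf
`Literature.NumberTheory.LFunctions.NoExceptionalZeroUpTo_4e5_fifth` (D-0061 alt-closer 'closes rung
F-P2n of Parity'; body `NoExceptionalZeroUpTo 400000 (1/5)`) AS A KERNEL THEOREM. RE-GLUED
2026-08-26 (theory g7) after the Theorem21-free close landed: it suffices to show X1a ∧ X1b, where
X1a (LightRows) and X1b (HeavyRows) = the kernel replay of one LZZ Table-1 prime-sum certificate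
(2.5) at c = 1/5 per fundamental discriminant 23 < |d| ≤ 4·10⁵ (171 068 light + 72 039 heavy kernel
`decide` rows, over the kernel base q ≤ 52 and the Epstein small-k rows) — BOTH CLOSED (p445005 and
predecessors) — because the only analytic input the decision rule needs, LZZ Theorem 2.1 RESTRICTED
to 3 ≤ q ≤ 4·10⁵ and real zeros β₁ ∈ (½,1) (`LuZamanZhao2026.theorem21UpTo 400000`), is now PROVED
in Literature (`theorem21UpTo_fourHundredThousand`, p459091) from the global Hadamard inequality for
−Re L′/L(σ,χ) that keeps the partner-zero term 1/(σ−1+β₁) (p455858) plus eight `decide +kernel`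
interval evaluations; the replay bridges on `theorem21UpTo Q` are p459371 and the unconditional leaf
`Theorems.noExceptionalZeroUpTo_4e5_fifth` is p459511 (axioms propext / Classical.choice /
Quot.sound only). The former second conjunct X2 (Theorem21 = LZZ Thm 2.1 AS PRINTED, all q) is no
longer load-bearing and is kept as an aside (a typed named fact, unproved, never claimed); the
method's ceiling is q ≈ 4.32·10⁵ (odd χ, λ = 1.6), so nothing beyond the leaf is asserted. Currency:
kernel, unconditional; instrument/kernel-replay record, not a new zero-free region; no Parity credit
(H5).
Lean: `Literature.NumberTheory.LFunctions.NoExceptionalZeroUpTo 400000 (1/5)`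

## Assembly
`closes (h1 : LightRows) (h2 : HeavyRows) : NoExceptionalZeroUpTo_4e5_fifth :=
Replay.noExceptionalZeroUpTo_of_light_heavy_upTo theorem21UpTo_fourHundredThousand h1 h2`
(glue-noitem.lean, prover g5 / theory g7; pre-checked rc 0, standard axioms) concludes the leaf
`NoExceptionalZeroUpTo_4e5_fifth` (= `NoExceptionalZeroUpTo 400000 (1/5)`).

CLOSES_TARGET: closes rung F-P2n of Parity: Literature.NumberTheory.LFunctions.NoExceptionalZeroUpTo_4e5_fifth (D-0061; not the summit Statement) — the deciding theorem of this route concludes that registered leaf instead of the Statement decl `GeneralizedHardyLittlewood` (class rung: servable and labelled, never counted as concluding the summit Statement).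

UNDER FLOOR: fewer than 2 cruxes remain after retriage (legacy route; D-0019).

Rationale: WHY THIS LINE. Mechanism: Lu–Zaman–Zhao (arXiv:2602.03626 = doi:10.1090/mcom/4268, Thm 2.1 and
(2.2)–(2.5)) reduce "no real zero in
[1 − c/log q, 1]" to ONE decidable inequality per character: a finite prime sum Σ_{p ≤ N} (log
p/(p^σ' − 1) + χ(p) log p/(p^σ' − χ(p)))
at σ' = 1 + r exceeding an explicit right-hand side; the tree already proves the decision rule
(`LuZamanZhao2026.lfunction_ne_zero_of_rhs_lt_primeSum`, `noExceptionalZeroUpTo_of_certificates`,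
p402817; discriminant form p403221)
and holds a validated-numerics substrate (`Literature/Analysis/ValidatedNumerics`, Ford `rowCheck`
pattern `FordRowCheck.lean`:
`decide +kernel` on dyadic balls + a soundness lemma). So each row is a kernel computation over big
rationals with table-shared
enclosures of log p and p^{−σ'} — unlike the wide theta certificates, whose incomplete-gamma terms
share nothing across d. Imported:
certified computation / proof-by-reflection engineering (Hales–Flyspeck style), nothing else. No
prior route does this; the printed
result (LZZ Thm 1.1 to 10¹⁰, Platt to 4·10⁵) is known — the delta is kernel status, said plainly
(FRONTIER ledger, formalization line).

RANKED CRUXES. #2 ReplayedCertificates (crux) — assuming LZZ Theorem 2.1 as printed, no primitive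
quadratic χ mod 3 ≤ q ≤ 4·10⁵ has a real zero in (0,1] ∩ [1 − 1/(5 log q), 1] — by kernel replay of
243 165 Table-1 certificates (row λ = 1.6; max N = 11 976 285 primes at six rows, median ≈ 2¹¹)
through `noExceptionalZeroUpTo_of_certificates` / the discriminant form, base
`noExceptionalZeroUpTo_twentyThree` (p403994), d = −163 by the tree's Chowla-163 positivity file;
currency: kernel modulo the printed fact. [difficulty: L] (why it might fail: kernel cost: ≈ 5·10⁸
big-rational interval ops via `decide +kernel` over ~250 files may exceed farm budgets; the six rows
needing N ≈ 1.2·10⁷ primes (and −163) may be out of kernel reach and need an analytic side lemma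
instead.) [arXiv:2602.03626, doi:10.1090/mcom/4268, Platt2016GRH]
#3 Theorem21 (crux) — Lu–Zaman–Zhao Theorem 2.1 as printed: for χ primitive mod q ≥ 3 with a real
zero β₁ ∈ (0,1) and σ = 1 + r, Σ_n Λ(n)(1 + Re χ(n))/n^σ ≤ 1/r − 1/(σ − β₁) + (σ − β₁)/R² + ϕ log q
+ E with R = r + 7/8 and (r, ϕ, E) from Table 1 — discharged in the kernel (Cor. 6.4: explicit
formula on a circle of radius r + 7/8, explicit convexity bound via Phragmén–Lindelöf/Rademacher, ≈
14 pp., then certified evaluation at the four r). [difficulty: XL] (why it might fail: the printed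
Table-1 constants (ϕ, E) come from the authors' own arb evaluation of Cor. 6.4; a formal proof may
only certify slightly weaker constants, which would void the λ = 1.6 rows with the thinnest margins
and force re-issued certificates.) [arXiv:2602.03626, doi:10.1090/mcom/4268, MontgomeryVaughan2007]

TWO-LAYER PLAN. ReplayedCertificates ⇐ (Rung1: 23 < |d| ≤ 10⁴, ≈ 6 080 rows, the engineering
proof-of-concept) → (Rung2: 10⁴ < |d| ≤ 4·10⁵ minus the
six deep rows) → (Deep rows: the six d needing N > 3·10⁷ and d = −163, by a side lemma or deeper
tables) → ReplayedCertificates; glue =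
`noExceptionalZeroUpTo_of_discriminant_certificates` chained in |d|. Filed as a split only after
Rung1 lands.

KILL CRITERIA. A kernel-evaluated certificate that FAILS where lineage B's integer run certified
(same d, row, N) sends lineage B to audit and, if
confirmed, removes that d from the certified set (the statement survives via Platt, the route's
currency claim does not). A formal
proof of Thm 2.1 yielding constants weaker than Table 1 at λ = 1.6 kills the rows of record
(re-issue at λ = 1.3/1.2/1.1 or larger N).
If kernel throughput at Rung1 extrapolates beyond ~10³ farm-hours for 4·10⁵, close `exhausted` and
keep the leaf at certified-numerics
currency under route RealCharacterThetaLadder (W ⇒ N).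

NOT DECOMPOSED YET. No per-file / per-batch items (the ~250 replay files attach with `--supports
ReplayedCertificates`); no item for the Kronecker-symbol
evaluation of χ_d(p) (tree `PrimitiveQuadraticCharacterKronecker*`, `…PrimeValues` p402879 — cited
by name); no split of Theorem21
into its §3–§6 lemmas before a prover has read the 14 pages against Mathlib's L-function API.

CHEAPEST FALSIFIER. Rung1 timing: replay the 100 rows 23 < |d| ≤ 420 in ONE kernel file with the
Ford `rowCheck` pattern and measure `decide +kernel`
seconds per (d, prime); > 10 ms per term (≈ 5·10⁸ terms total) kills the line on cost. Not run by me
(planner seat: no proposals).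

NUMBERS. c = 1/5; Table 1 row λ = 1.6: r = 1.6/(10 log 10) = 0.06949, ϕ = 0.22675, E = 1.1614, R = r
+ 7/8; rows of record j242991:
243 165/243 171 fundamental d with |d| ≤ 4·10⁵ certified at λ = 1.6 (the 6 missing = the base set
inside |d| ≤ 23, kernel by p403994);
stage counts: p ≤ 2·10⁶ left 101 rows, p ≤ 3·10⁷ left 11, p ≤ 3·10⁸ left 6; max N = 11 976 285
primes. Consumers' width floor:
c ≥ 1/R₁ = 0.10367 (BMOR2018 Lemma 6.12) — met by 1/5.

DEFINITION REQUESTS. None. The rung leaf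
`Literature.NumberTheory.LFunctions.NoExceptionalZeroUpTo_4e5_fifth : Prop := NoExceptionalZeroUpTo
400000 (1/5)`
is landed by the cell's rc-prover (INBOX 2026-08-25T18:58:04Z); until then `closes` concludes the
body.

Novelty: Searches (2026-08-25): lit search "Landau-Siegel zeros numerical computations" --source all (local:
arXiv:2602.03626 pp.1,16,20, arXiv:2301.10722 p.9; remote: doi:10.1090/mcom/4268,
doi:10.1016/j.jnt.2023.04.008, Sarnak–Zaharescu 2002); lit search --hybrid "real zeros of quadratic
Dirichlet L-functions verified computation discriminant" (textbook hits only: Montgomery–Vaughan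
2007 p.109, Cohen 1993 pp.335–339, Buell 1989); lit galaxy search "real zeros of real|Landau-Siegel
zero|no Siegel zero" --star all (21 rows, no formalization or kernel-verified table); lean search
'rowCheck' (tree FordRowCheck.lean pattern), lean search 'noExceptionalZeroUpTo_of_certificates'
(p402817).
Nearest prior art found: arXiv:2602.03626 [corpus:arxiv-2602.03626 p.1,4] (the algorithm and Thm 1.1
to 10¹⁰, arb ball arithmetic, not kernel); Platt2016GRH (q ≤ 4·10⁵ wide, not kernel); in-tree
Ford–Kadiri row replay `Literature.NumberTheory.LFunctions.FordRowCheck` (the kernel pattern, other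
inequality).
Delta: first kernel-checked (Lean) exclusion of exceptional zeros for an explicit range of real
characters, modulo one printed analytic inequality that is itself an item; mathematically the result
is known.
Claimed grade: known  [refs: 10.1090/mcom/4268, 10.1016/j.jnt.2023.04.008, 2602.03626, 2301.10722, doi:10.1090/mcom/4268, doi:10.1016/j.jnt.2023.04.008, arxiv-2602.03626]

Barriers (technique_class: kernel-replay, explicit-inequality, interval-arith): - technique_class: kernel-replay, explicit-inequality, interval-arith
- Literature.Barriers.Parity.SiegelZeroTwinPrimes: not in its class — a finite range q ≤ 4·10⁵ says
nothing about unbounded-quality Siegel zeros or prime pairs (cell H4/H5); the route is an instrument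
with kernel currency, not a summit move.
- Literature.Barriers.Parity.SiegelZeroPrimePairBarrier: outside its class — no shift-uniform
prime-pair bound is claimed or used. (Uncatalogued for Parity but relevant: the RH-side Epstein
class-sum kernel method `Literature/Barriers/RiemannHypothesis/EpsteinZetaRealZerosSmallK.lean`
stops at d ≈ 200; evaded by changing the certificate — prime sums at σ' = 1 + r (LZZ) share
log-tables across d and stay rational-interval computations.)
- Negatives index: empty for these statements at filing; the A1 counterexample (L(−1,χ₃) = 0 against
a window without `0 < σ`) is built into the landed `NoExceptionalZeroUpTo`.

History (route lifecycle, newest last):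
- 2026-08-25T23:15:25Z · closes_target -> closes rung F-P2n of Parity: Literature.NumberTheory.LFunctions.NoExceptionalZeroUpTo_4e5_fifth (D-0061; not the summit Statement) (planner-parity-realchar-theory-g3-0)
- 2026-08-26T18:39:25Z · CLOSED proved — proved:Summit.Parity.GeneralizedHardyLittlewood.Theorems.noExceptionalZeroUpTo_4e5_fifth (planner-parity-realchar-theory-g7-0)

sub-problem: GeneralizedHardyLittlewood · status: closed(proved) · opened planner-parity-realchar-theory-g3-0 2026-08-25T22:18:22Z · rev 7 · ledger route-Parity-LZZCertificateReplay
GENERATED by the gate from the ledger (D-0016/17). Provers cite these decls: `theorem foo : Summit.Parity.GeneralizedHardyLittlewood.Theses.LZZCertificateReplay.<Decl> := …` in Summits/Parity/GeneralizedHardyLittlewood/Theorems/<Name>.lean.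
-/

namespace Summit.Parity.GeneralizedHardyLittlewood.Theses.LZZCertificateReplay

open scoped BigOperators Topology Manifold Classical MeasureTheory ProbabilityTheory Matrix InnerProductSpace ComplexConjugate ContinuousMap
open Filter Set Function TopologicalSpace MeasureTheory

attribute [summit_statement] _root_.GeneralizedHardyLittlewood
attribute [summit_statement] _root_.Literature.NumberTheory.LFunctions.NoExceptionalZeroUpTo_4e5_fifth

/-- item stmt-Parity-19786 · crux · rank 2 · closed · proved by Summit.Parity.GeneralizedHardyLittlewood.Theorems.SplitClosure.LZZCertificateReplay.ReplayedCertificates_holds @ 0141e1a979ea (prover) · by planner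
why it might fail: kernel cost: ≈ 5·10⁸ big-rational interval ops via `decide +kernel` over ~250 files may exceed farm budgets; the six rows needing N ≈ 1.2·10⁷ primes (and −163) may be out of kernel reach and need an analytic side lemma instead.
sources: arXiv:2602.03626, doi:10.1090/mcom/4268, Platt2016GRH
[crux] assuming LZZ Theorem 2.1 as printed, no primitive quadratic χ mod 3 ≤ q ≤ 4·10⁵ has a real
zero in (0,1] ∩ [1 − 1/(5 log q), 1] — by kernel replay of 243 165 Table-1 certificates (row λ =
1.6; max N = 11 976 285 primes at six rows, median ≈ 2¹¹) through
`noExceptionalZeroUpTo_of_certificates` / the discriminant form, base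
`noExceptionalZeroUpTo_twentyThree` (p403994), d = −163 by the tree's Chowla-163 positivity file;
currency: kernel modulo the printed fact. [difficulty: L] -/
@[route_item "route-Parity-LZZCertificateReplay"]
def ReplayedCertificates : Prop :=
  Literature.NumberTheory.LFunctions.LuZamanZhao2026.theorem21 → Literature.NumberTheory.LFunctions.NoExceptionalZeroUpTo 400000 (1 / 5)

-- `ReplayedCertificates` holds: proved by `Summit.Parity.GeneralizedHardyLittlewood.Theorems.SplitClosure.LZZCertificateReplay.ReplayedCertificates_holds` @ 0141e1a979ea (its module imports this route file, so no `_holds` link can be stated here).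

-- parent: ReplayedCertificates · child (gen 1)
/--     item stmt-Parity-19293 · crux · rank 201 · closed · proved by Summit.Parity.GeneralizedHardyLittlewood.Theorems.lightRows_holds (prover)
    parent: ReplayedCertificates · by planner
    why it might fail: false only if the exact-rational checker rejects a row the float pre-pass (10⁻⁸ two-sided margins) classified light — such a row would have to move to heavyList15, i.e. a restatement; practically a Range file may exceed the farm's elaboration budget and need re-windowing.
    sources: arXiv:2602.03626, LuZamanZhao2026
[crux] LIGHT rows of the LZZ Proposition-1.5 replay at c = 1/5 below Q = 4·10⁵: every fundamental
discriminant D with 23 < |D| ≤ 400000 NOT in heavyList15 (the 72 088 rows whose light certificate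
needs primes beyond 32 749 = π⁻¹(3512), prover heavy15.txt sha 38e5cb95…) is CertifiedAt (1/5) — Q0
= 23 kept although the kernel base is now 52 (CertifiedRange from 23 is more than needed); closed by
the prover's kernel `decide` Range files over table15 (171 068 rows, Σ ≈ 2.08·10⁸ prime terms)
assembled by CertifiedRange.append + certifiedRange_except_mono; currency: kernel (standard axioms),
referee V47/V61. -/
@[route_item "route-Parity-LZZCertificateReplay", crux]
def LightRows : Prop :=
  Literature.NumberTheory.LFunctions.LuZamanZhao2026.Replay.CertifiedRange (1 / 5) 23 400000 Literature.NumberTheory.LFunctions.LuZamanZhao2026.Replay.heavyList15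

-- `LightRows` holds: proved by `Summit.Parity.GeneralizedHardyLittlewood.Theorems.lightRows_holds` (its module imports this route file, so no `_holds` link can be stated here).

-- parent: ReplayedCertificates · child (gen 1)
/--     item stmt-Parity-19294 · crux · rank 202 · closed · proved by Summit.Parity.GeneralizedHardyLittlewood.Theorems.heavyRows_holds (prover)
    parent: ReplayedCertificates · by planner
    why it might fail: false only if LZZ's Prop-1.5 inequality at c = 1/5 fails for some heavy D < 4·10⁵ with every admissible N (print and the float pre-pass say it holds for all 72 088); practically the deepest rows (p_N ≈ 6·10⁶, ≈ 4·10⁵ primes) may exceed the farm's per-file budget.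
    sources: arXiv:2602.03626, LuZamanZhao2026
[crux] HEAVY rows of the LZZ replay at c = 1/5 below Q = 4·10⁵: every D ∈ heavyList15 that is NOT
settled by mathematics in the tree (`direct D = false`: excludes 3 ≤ |D| ≤ 52 —
`noRealZeroUpTo_fiftyTwo`, p417933 — and odd 5 ≤ |D| ≤ 163 — Epstein small-k, p419332; 49 deep rows
incl. −163, 24, 29, 28, −67, −43 leave the campaign) is CertifiedAt (1/5) — closed by the prover's
kernel `decide` files over table15 row by row / window by window (72 039 rows, ≈ 8.55·10⁸ prime
terms, max p_N = 5.88·10⁶ at D = −222643); currency: kernel (standard axioms), referee V47/V61; glue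
`noExceptionalZeroUpTo_of_light_heavy` (prover Split file). -/
@[route_item "route-Parity-LZZCertificateReplay", crux]
def HeavyRows : Prop :=
  ∀ D ∈ Literature.NumberTheory.LFunctions.LuZamanZhao2026.Replay.heavyList15, Literature.NumberTheory.LFunctions.LuZamanZhao2026.Replay.direct D = false → Literature.NumberTheory.LFunctions.LuZamanZhao2026.Replay.CertifiedAt (1 / 5) D

-- `HeavyRows` holds: proved by `Summit.Parity.GeneralizedHardyLittlewood.Theorems.heavyRows_holds` (its module imports this route file, so no `_holds` link can be stated here).

-- parent: ReplayedCertificates · glue (gen 1)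
/--     item stmt-Parity-19298 · aside · rank 203 · closed · proved by Summit.Parity.GeneralizedHardyLittlewood.Theorems.replayedCertificatesGlue_holds (prover)
    parent: ReplayedCertificates · GLUE: children ⟹ parent · by planner
LightRows → HeavyRows → ReplayedCertificates — proof: fun hl hh h21 =>
Literature.NumberTheory.LFunctions.LuZamanZhao2026.Replay.noExceptionalZeroUpTo_of_light_heavy h21
hl hh (p419723; pre-flighted in theory SplitSketch3.lean rc 0) -/
@[route_item "route-Parity-LZZCertificateReplay"]
def ReplayedCertificatesGlue : Prop :=
  LightRows → HeavyRows → ReplayedCertificates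

-- `ReplayedCertificatesGlue` holds: proved by `Summit.Parity.GeneralizedHardyLittlewood.Theorems.replayedCertificatesGlue_holds` (its module imports this route file, so no `_holds` link can be stated here).

/-- item stmt-Parity-19787 · crux · rank 3 · closed · moot by None · by planner
why it might fail: the printed Table-1 constants (ϕ, E) come from the authors' own arb evaluation of Cor. 6.4; a formal proof may only certify slightly weaker constants, which would void the λ = 1.6 rows with the thinnest margins and force re-issued certificates.
sources: arXiv:2602.03626, doi:10.1090/mcom/4268, MontgomeryVaughan2007
[crux] Lu–Zaman–Zhao Theorem 2.1 as printed: for χ primitive mod q ≥ 3 with a real zero β₁ ∈ (0,1)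
and σ = 1 + r, Σ_n Λ(n)(1 + Re χ(n))/n^σ ≤ 1/r − 1/(σ − β₁) + (σ − β₁)/R² + ϕ log q + E with R = r +
7/8 and (r, ϕ, E) from Table 1 — discharged in the kernel (Cor. 6.4: explicit formula on a circle of
radius r + 7/8, explicit convexity bound via Phragmén–Lindelöf/Rademacher, ≈ 14 pp., then certified
evaluation at the four r). [difficulty: XL] -/
@[route_item "route-Parity-LZZCertificateReplay"]
def Theorem21 : Prop :=
  Literature.NumberTheory.LFunctions.LuZamanZhao2026.theorem21

/-- item stmt-Parity-19788 · assembly · rank 1 · closed · proved by Summit.Parity.GeneralizedHardyLittlewood.Theorems.lzzCertificateReplay_assembly_proof @ 2ec3f7057781 (prover) · by planner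
sources: arXiv:2602.03626
[assembly] ReplayedCertificates → Theorem21 → no exceptional zero up to 4·10⁵ at width 1/5. -/
@[route_item "route-Parity-LZZCertificateReplay"]
def Assembly : Prop :=
  ReplayedCertificates → Theorem21 → Literature.NumberTheory.LFunctions.NoExceptionalZeroUpTo 400000 (1 / 5)

-- `Assembly` holds: proved by `Summit.Parity.GeneralizedHardyLittlewood.Theorems.lzzCertificateReplay_assembly_proof` @ 2ec3f7057781 (its module imports this route file, so no `_holds` link can be stated here).

/-! D-0027 §2.1 — DECIDING THEOREM (planner-authored via `route open/edit --closes-file`; by planner-parity-realchar-theory-g7-0 2026-08-26T18:30:15Z) — ARCHIVED: route closed (proved) 2026-08-26T18:39:25Z; kept so importers keep building: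
its hypotheses are this route's items and its conclusion the registered leaf `Literature.NumberTheory.LFunctions.NoExceptionalZeroUpTo_4e5_fifth` (rung F-P2n, D-0061) (glue_lint), and it elaborates with this file. -/

@[closes "route-Parity-LZZCertificateReplay"] theorem closes (h1 : LightRows) (h2 : HeavyRows) :
    Literature.NumberTheory.LFunctions.NoExceptionalZeroUpTo_4e5_fifth := by
  show Literature.NumberTheory.LFunctions.NoExceptionalZeroUpTo 400000 (1 / 5)
  exact Literature.NumberTheory.LFunctions.LuZamanZhao2026.Replay.noExceptionalZeroUpTo_of_light_heavy_upTo
    Literature.NumberTheory.LFunctions.LuZamanZhao2026.theorem21UpTo_fourHundredThousand h1 h2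

end Summit.Parity.GeneralizedHardyLittlewood.Theses.LZZCertificateReplay
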